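import Mathlib.Analysis.InnerProductSpace.PiL2
import Mathlib.Geometry.Manifold.IsManifold.Basic
import Mathlib.Geometry.Manifold.Instances.Real
import Literature.Topology.FourManifolds.SurfaceSmoothingAtlas
import HarnessLib

/-!
# From a planar atlas to a `C^∞` structure modelled on `ℝ²` (surface-smoothing programme, P9 core)

Topic `Literature/Topology/FourManifolds` (the `n = 2` leaf of
`Literature.Topology.FourManifolds.exists_chartedSpace_isManifold_of_le_three`, spc4.S33, seat 1 /
approach B; sequel to `SurfaceSmoothingAtlas.lean`). **Everything is proved; no named fact.**

The smoothing fact is stated for charted spaces modelled on `EuclideanSpace ℝ (Fin 2)` with the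
model with corners `𝓡 2`, while the seam construction produces a `PlanarAtlas X univ` (charts
valued in `ℂ`). This file converts: composing every chart with the real-linear isometry
`ℂ ≃ₗᵢ[ℝ] EuclideanSpace ℝ (Fin 2)` of the orthonormal basis `(1, i)`
(`Complex.orthonormalBasisOneI`) gives a `ChartedSpace (EuclideanSpace ℝ (Fin 2)) X` structure
whose transition maps are the planar ones conjugated by a linear isometry, hence `C^∞`
(`isManifold_of_contDiffOn`):

* `PlanarAtlas.exists_chartedSpace_euclidean_isManifold` — for a planar atlas `𝒜` on all of `X`
  there is `c : ChartedSpace (EuclideanSpace ℝ (Fin 2)) X` with `IsManifold (𝓡 2) ∞ X` (w.r.t.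
  `c`), in exactly the form of the conclusion of the smoothing fact.
-/

noncomputable section

open Set Function
open scoped Manifold ContDiff Topology

namespace Literature.Topology.FourManifolds

namespace SurfaceSmoothing

namespace PlanarAtlas

variable {X : Type*} [TopologicalSpace X]

/-- The real-linear isometry `ℂ ≃ ℝ²` of the orthonormal basis `(1, i)`, as a continuous linear
equivalence. [folklore] -/
def toEuclidean : ℂ ≃L[ℝ] EuclideanSpace ℝ (Fin 2) :=
  Complex.orthonormalBasisOneI.repr.toContinuousLinearEquiv

/-- **A planar atlas on all of `X` gives a `C^∞` structure modelled on `ℝ²`** (`EuclideanSpace ℝ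
(Fin 2)`, model with corners `𝓡 2`): compose the charts with the linear isometry `ℂ ≃ ℝ²`.
This is the form of the conclusion of
`Literature.Topology.FourManifolds.exists_chartedSpace_isManifold_of_le_three` (case `n = 2`).
[folklore] -/
theorem exists_chartedSpace_euclidean_isManifold (𝒜 : PlanarAtlas X (univ : Set X)) :
    ∃ c : ChartedSpace (EuclideanSpace ℝ (Fin 2)) X,
      @IsManifold ℝ _ _ _ _ _ _ (𝓡 2) ∞ X _ c := by
  let L : ℂ ≃L[ℝ] EuclideanSpace ℝ (Fin 2) := toEuclidean
  -- a chart at every point, read in `ℝ²`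
  have hch : ∀ x : X, ∃ e ∈ 𝒜.charts, x ∈ e.source := fun x => 𝒜.covers x (mem_univ x)
  let ψ : X → OpenPartialHomeomorph X ℂ := fun x => (hch x).choose
  have hψmem : ∀ x, ψ x ∈ 𝒜.charts := fun x => (hch x).choose_spec.1
  have hψx : ∀ x, x ∈ (ψ x).source := fun x => (hch x).choose_spec.2
  let Ψ : X → OpenPartialHomeomorph X (EuclideanSpace ℝ (Fin 2)) := fun x =>
    (ψ x).transHomeomorph L.toHomeomorph
  let c : ChartedSpace (EuclideanSpace ℝ (Fin 2)) X :=
    { atlas := range Ψ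
      chartAt := Ψ
      mem_chart_source := fun x => hψx x
      chart_mem_atlas := fun x => mem_range_self x }
  refine ⟨c, @isManifold_of_contDiffOn ℝ _ (EuclideanSpace ℝ (Fin 2)) _ _ (EuclideanSpace ℝ (Fin 2))
    _ (𝓡 2) ∞ X _ c ?_⟩
  rintro _ _ ⟨x, rfl⟩ ⟨y, rfl⟩
  simp only [modelWithCornersSelf_coe, modelWithCornersSelf_coe_symm, Function.id_comp,
    Function.comp_id, preimage_id_eq, id_eq, range_id, inter_univ]
  -- the transition map of `Ψ x`, `Ψ y` is `L ∘ (transition of ψ x, ψ y) ∘ L.symm`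
  have hsmooth : ContDiffOn ℝ ∞ ((ψ x).symm.trans (ψ y)) ((ψ x).symm.trans (ψ y)).source :=
    ((𝒜.compat (ψ x) (hψmem x) (ψ y) (hψmem y)).1).congr fun z _ => rfl
  have key : ContDiffOn ℝ ∞ (L ∘ ((ψ x).symm.trans (ψ y)) ∘ L.symm)
      (L.symm ⁻¹' ((ψ x).symm.trans (ψ y)).source) :=
    L.contDiff.comp_contDiffOn (hsmooth.comp L.symm.contDiff.contDiffOn fun _ hv => hv)
  exact key

end PlanarAtlas

end SurfaceSmoothing

end Literature.Topology.FourManifolds
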